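import Literature.Probability.RandomPlanarGeometry.LatticeFlowLinePassage
import HarnessLib

/-!
# Lattice `κ = 8/3` imaginary-geometry boundary data on the two arcs of a discrete Dobrushin domain

Definition file (request `defn-triBoundaryWinding` = D3 of route CriticalPhenomena/SAWScalingLimit/
SAWTiltedExplorer; consumer: the restated crux `TiltedExplorerKSRegular`, stmt-CriticalPhenomena-13918,
which reads `triBoundaryWinding (E δ) (m δ)` as the arc data `β_δ` of
`tiltedExplorerMeasure (E δ) β_δ (1/3) (g δ)` under the hypothesis `(E δ).IsTwoChain`; intended
witness of the support item `BoundaryWindingData` / `IsBoundaryWindingDatum`). Companion of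
`TiltedExplorer.lean`, `LatticeFlowLineHarmonic.lean` and `LatticeFlowLinePassage.lean` (same
topic), whose vocabulary it reuses (`explorationWalk`, `explorationFaces`, `hexCenter`,
`hexPathTurn`, `dartAngle`, `centredWindowAngle`, `firstPassage`, `passedHexagons`,
`tiltedExplorerInitAngle`, `gaugeAnchor`, `tiltedBankLeft`, `tiltedBankRight`).

## The object

Miller–Sheffield (IG I, arXiv:1201.1496, Thm. 1.1, Fig. 1.10, §1.2): the flow line from `0` of the
GFF on `ℍ` with boundary data `−λ` on `ℝ₋` (its LEFT) and `+λ` on `ℝ₊` (its RIGHT) is chordal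
`SLE_κ`, `λ = π/√κ`; along the path the data are `∓λ' + χ · winding` ("each time the path makes a
quarter turn to the left, heights go up by `(π/2) χ`"), `λ' = π/√κ'`, `χ = 2/√κ − √κ/2`. In the
route's units `λ' = 1` and for `κ = 8/3`: `λ = 3/2`, `χ = 1/π`. On a general Dobrushin domain the
two boundary arcs are read as walls with winding: a wall of direction `Â` keeping the domain's
curve frame on its LEFT side carries `−3/2 + (Â − π)/π` (`arcAProfile`; `−λ` for the west-running
left wall `Â = π` of the north-going flow line), a wall on the RIGHT carries `+3/2 + Â/π`
(`arcBProfile`; `+λ` for the east-running right wall `Â = 0`).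

The LATTICE version reads the wall directions off the two boundary-hugging hexagonal exploration
paths of the discrete Dobrushin domain `E` (`LatticeInterface.lean`): `P_A = explorationFaces E ∅`,
the interface of the all-closed configuration (every step keeps an arc-`A` hexagon on its LEFT: it
hugs the discrete arc `A` from `a_δ` to `b_δ`), and `P_B = explorationFaces E univ`, the interface
of the all-open configuration (closed = `B ∖ A` on its RIGHT: it hugs the arc `B`). Directions are
the EXACT unwrapped dart angles in the ZERO GAUGE, `A_i = dartAngle 0 P i` (anchor = the
representative of `arg (c₁ − c₀)` closest to `π/2`, then `±π/3` per turn, no slips), smoothed over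
a centred window of `2m + 1` darts: `Â_m(i) = centredWindowAngle 0 P m i =
A_i + pv (arg (c_{i+1+m} − c_{i−m}) − A_i)`. This IS the centred-window direction
`centredWindowAngle` of `LatticeFlowLinePassage.lean` taken at `β = 0` — not a third notion, and not
the one-sided cumulative `windowAngle` of `LatticeFlowLineHarmonic.lean` (which slips by `2π` at
near-closures of the chord). VALUES of `triBoundaryWinding E m`:

* `u ∈ E.triArcA`, `i₀ = firstPassage P_A u` (`u` on the LEFT of that dart):
  `β u = −3/2 + (Â^{P_A}_m(i₀) − π)/π` (`triArcAWinding`);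
* `u ∈ E.triArcB ∖ E.triArcA` (`A` wins on an overlap, as in `bcConfig`), `i₀ = firstPassage P_B u`:
  `β u = +3/2 + Â^{P_B}_m(i₀)/π` (`triArcBWinding`);
* `β u = 0` off the arcs (never read: the explorer data are `β` only on the arcs).

`DiscreteDobrushin.IsTwoChain E` is the hygiene hypothesis making these data meaningful — the
lattice transcription of Kemppainen–Smirnov's admissible hexagonal domains (arXiv:1212.6215, §4.2:
`∂U = c₁ ∪ c₂`, two simple hexagonal chains from `a` to `b`, the boundary hexagons `V₁`, `V₂` being
those next to `c₁` resp. `c₂`): both hugging paths exist and every arc hexagon FACING THE INTERIOR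
(an `Ω_δ`-neighbour on neither arc) is actually PASSED by its hugging path, so that its datum is
read off a dart running along it (`IsTwoChain.firstPassage_lt_of_mem_triArcA`); mislabelled
boundary islands violate it.

## The three sign checks (all proved)

1. Half-plane picture (`arcAProfile_pi`, `arcBProfile_zero`, `arcAProfile_add`, `arcBProfile_add`):
   first dart north, `A`-wall on its left running west `↦ −3/2`, `B`-wall on its right running east
   `↦ +3/2`; a left turn by `θ` raises both by `θ/π = χ θ`.
2. Gauge identity (`IsCommonFirstDart.gauge_triBoundaryWinding_zero`,
   `….tiltedExplorerInitAngle_triBoundaryWinding_zero`, `….dartAngle_triBoundaryWinding_zero`): if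
   both hugging paths start with the dart `f₀ → f₁` across the `A`–`B` edge `{x_a, y_b}` then, for
   `m = 0`, `π (β x_a + β y_b)/2 + π/2 = A₀ = tiltedExplorerInitAngle 0 f₀ f₁`, hence the explorer's
   gauge anchored on `β` IS the zero gauge: `tiltedExplorerInitAngle β f₀ f₁ = A₀` and
   `dartAngle β P = dartAngle 0 P`; for `m > 0` the target is within `π` of `A₀`
   (`….abs_gaugeTarget_sub_le`) and the same conclusion holds whenever it is strictly within `π`
   (`tiltedExplorerInitAngle_eq_of_abs_sub_lt`).
3. Wall offsets (`arcAProfile_sub_tiltedBankLeft`, `arcBProfile_sub_tiltedBankRight`): along a wall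
   parallel to the entering dart of direction `A` (`Â = A`), tilt `c = 1/3`:
   `β_A − f_L = −(5/3 − g)`, `β_B − f_R = +(5/3 − g)` — constant, repulsive for `g < 5/3`.

Also proved: unfolding lemmas; `firstPassage (explorationFaces E ω) u ≤ explorationLength E ω`;
the bounds `|β| ≤ 5 + (ℓ_∅ + ℓ_univ)/3` (`abs_triBoundaryWinding_le`) feeding the Dirichlet-problem
lemmas of the flow-line functionals (`isTriHarmonicExtension_latticeFlowLineHarmonicCentred_triBoundaryWinding`).
No named fact is introduced.

## Junk values (documented)

No (unique) exploration path (excluded by admissibility, `explorationWalk_isSome`) ⇒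
`triArcAWinding = −3/2`, `triArcBWinding = +3/2` (the straight-wall constants),
`explorationLength = 0` and `IsTwoChain` is `False`; an arc hexagon never passed by its hugging path
gets `firstPassage`'s junk index `0` (harmless under `IsTwoChain`); the backward half-window is
truncated at the start of the path (`ℕ`-subtraction) and the forward one saturates at its end
(`getVert`), as in `LatticeFlowLinePassage.lean`.

## References

* J. Miller, S. Sheffield, *Imaginary geometry I: interacting SLEs*, PTRF 164 (2016) =
  arXiv:1201.1496, Thm. 1.1, Fig. 1.10, §1.2 (boundary data `∓λ`, `∓λ' + χ·winding`; the
  quarter-turn rule). [MillerSheffield2016]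
* A. Kemppainen, S. Smirnov, *Random curves, scaling limits and Loewner evolutions*, Ann. Probab.
  45 (2017) = arXiv:1212.6215, §4.2 (admissible hexagonal two-arc domains). [KemppainenSmirnov2017]
* O. Schramm, S. Sheffield, Ann. Probab. 33 (2005) = arXiv:math/0310210, §2. [SchrammSheffield2005]
* S. Smirnov, C. R. Acad. Sci. 333 (2001), §2 (hexagonal exploration). [Smirnov2001]
-/

noncomputable section

open Finset

namespace Literature.Probability.RandomPlanarGeometry

open Literature.Probability.LatticeModels Literature.Probability.Percolation

/-! ### The two wall profiles (IG I boundary data, `κ = 8/3`, units `λ' = 1`) -/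

/-- **The arc-`A` (left-wall) profile** `−3/2 + (Â − π)/π`: the `κ = 8/3` imaginary-geometry
boundary datum (units `λ' = 1`, `λ = 3/2`, `χ = 1/π`) on a wall of direction `Â` lying on the LEFT
of the curve frame — `−λ = −3/2` on the west-running (`Â = π`) left wall of the north-going flow
line, raised by `χ θ` per left turn `θ` of the wall. [cite: MillerSheffield2016, Thm. 1.1, Fig. 1.10 and §1.2] -/
def arcAProfile (a : ℝ) : ℝ := -(3 / 2) + (a - Real.pi) / Real.pi

/-- **The arc-`B` (right-wall) profile** `+3/2 + Â/π`: `+λ = 3/2` on the east-running (`Â = 0`)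
right wall of the north-going flow line, raised by `χ θ` per left turn `θ`. [cite: MillerSheffield2016, Thm. 1.1, Fig. 1.10 and §1.2] -/
def arcBProfile (a : ℝ) : ℝ := 3 / 2 + a / Real.pi

/-- Sign check (1), left wall: the west-running `A`-wall carries `−λ = −3/2`. [cite: MillerSheffield2016, Thm. 1.1 and Fig. 1.10] -/
theorem arcAProfile_pi : arcAProfile Real.pi = -(3 / 2) := by simp [arcAProfile]

/-- Sign check (1), right wall: the east-running `B`-wall carries `+λ = 3/2`. [cite: MillerSheffield2016, Thm. 1.1 and Fig. 1.10] -/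
theorem arcBProfile_zero : arcBProfile 0 = 3 / 2 := by simp [arcBProfile]

/-- The winding rule on arc `A`: a left turn by `θ` raises the datum by `χ θ = θ/π`. [cite: MillerSheffield2016, §1.2 (quarter-turn rule)] -/
theorem arcAProfile_add (a θ : ℝ) : arcAProfile (a + θ) = arcAProfile a + θ / Real.pi := by
  simp only [arcAProfile]; ring

/-- The winding rule on arc `B`: a left turn by `θ` raises the datum by `χ θ = θ/π`. [cite: MillerSheffield2016, §1.2 (quarter-turn rule)] -/
theorem arcBProfile_add (a θ : ℝ) : arcBProfile (a + θ) = arcBProfile a + θ / Real.pi := by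
  simp only [arcBProfile]; ring

/-- `arcAProfile Â = Â/π − 5/2`. [folklore] -/
theorem arcAProfile_eq (a : ℝ) : arcAProfile a = a / Real.pi - 5 / 2 := by
  have hπ := Real.pi_ne_zero
  simp only [arcAProfile]; field_simp; ring

/-- Sign check (3), left wall offset: along a wall parallel to the entering dart of direction `A`,
with tilt `c = 1/3`, `β_A − f_L = −(5/3 − g)` (repulsive for `g < 5/3`). [folklore] -/
theorem arcAProfile_sub_tiltedBankLeft (g A : ℝ) :
    arcAProfile A - tiltedBankLeft (1 / 3) g A = -(5 / 3 - g) := by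
  have hπ := Real.pi_ne_zero
  simp only [arcAProfile, tiltedBankLeft]; field_simp; ring

/-- Sign check (3), right wall offset: `β_B − f_R = +(5/3 − g)`. [folklore] -/
theorem arcBProfile_sub_tiltedBankRight (g A : ℝ) :
    arcBProfile A - tiltedBankRight (1 / 3) g A = 5 / 3 - g := by
  have hπ := Real.pi_ne_zero
  simp only [arcBProfile, tiltedBankRight]; field_simp; ring

/-- The gauge algebra: `π (β_A(A + t) + β_B(A + t'))/2 + π/2 = A + (t + t')/2`. [folklore] -/
theorem gauge_arcProfile (A t t' : ℝ) :
    Real.pi * (arcAProfile (A + t) + arcBProfile (A + t')) / 2 + Real.pi / 2 = A + (t + t') / 2 := by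
  have hπ := Real.pi_ne_zero
  simp only [arcAProfile, arcBProfile]; field_simp; ring

/-- `|β_A(Â)| ≤ 5/2 + |Â|/π`. [folklore] -/
theorem abs_arcAProfile_le (a : ℝ) : |arcAProfile a| ≤ 5 / 2 + |a| / Real.pi := by
  rw [arcAProfile_eq]
  calc |a / Real.pi - 5 / 2| ≤ |a / Real.pi| + |(5 / 2 : ℝ)| := abs_sub _ _
    _ = 5 / 2 + |a| / Real.pi := by
        rw [abs_of_pos (by norm_num : (0 : ℝ) < 5 / 2), abs_div, abs_of_pos Real.pi_pos, add_comm]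

/-- `|β_B(Â)| ≤ 3/2 + |Â|/π`. [folklore] -/
theorem abs_arcBProfile_le (a : ℝ) : |arcBProfile a| ≤ 3 / 2 + |a| / Real.pi := by
  unfold arcBProfile
  calc |3 / 2 + a / Real.pi| ≤ |(3 / 2 : ℝ)| + |a / Real.pi| := abs_add_le _ _
    _ = 3 / 2 + |a| / Real.pi := by
        rw [abs_of_pos (by norm_num : (0 : ℝ) < 3 / 2), abs_div, abs_of_pos Real.pi_pos]

/-! ### Length and saturation of the exploration face sequence -/

/-- The number of darts of the exploration path of `ω` in `E` (junk `0` when there is no (unique)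
exploration path); `explorationFaces E ω` is constant from this index on. [cite: Smirnov2001, §2] -/
def explorationLength (E : DiscreteDobrushin) (ω : SiteConfig (Site 2)) : ℕ :=
  match explorationWalk E ω with
  | some γ => γ.2.2.length
  | none => 0

/-- Unfolding `explorationLength` when the exploration path is defined. [folklore] -/
theorem explorationLength_of_eq_some {E : DiscreteDobrushin} {ω : SiteConfig (Site 2)}
    {γ : Σ f g : HexVertex, hexGraph.Walk f g} (h : explorationWalk E ω = some γ) :
    explorationLength E ω = γ.2.2.length := by
  simp [explorationLength, h]

/-- The junk value of `explorationLength`. [folklore] -/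
theorem explorationLength_of_eq_none {E : DiscreteDobrushin} {ω : SiteConfig (Site 2)}
    (h : explorationWalk E ω = none) : explorationLength E ω = 0 := by
  simp [explorationLength, h]

/-- The face sequence saturates at the final face (`getVert` beyond the length). [folklore] -/
theorem explorationFaces_of_explorationLength_le {E : DiscreteDobrushin} {ω : SiteConfig (Site 2)}
    {i : ℕ} (hi : explorationLength E ω ≤ i) :
    explorationFaces E ω i = explorationFaces E ω (explorationLength E ω) := by
  cases h : explorationWalk E ω with
  | none => rw [explorationFaces_of_eq_none h, explorationFaces_of_eq_none h]
  | some γ =>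
    rw [explorationLength_of_eq_some h] at hi ⊢
    rw [explorationFaces_of_eq_some h, explorationFaces_of_eq_some h,
      γ.2.2.getVert_of_length_le hi, γ.2.2.getVert_of_length_le le_rfl]

/-- For an eventually constant face sequence the first-passage index never exceeds the
stabilisation time (passed hexagons are passed earlier; never-passed ones get the junk `0`). [folklore] -/
theorem firstPassage_le_of_eventually_const {P : ℕ → HexVertex} {L : ℕ}
    (hP : ∀ i, L ≤ i → P i = P L) (u : Site 2) : firstPassage P u ≤ L := by
  by_cases hu : u ∈ hexFaceVertices (P L)
  · refine firstPassage_le P ⟨hu, ?_⟩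
    rw [hP (L + 1) (Nat.le_succ L)]
    exact hu
  · by_contra hlt
    rw [not_le] at hlt
    have hne : ({i : ℕ | u ∈ hexFaceVertices (P i) ∧ u ∈ hexFaceVertices (P (i + 1))} :
        Set ℕ).Nonempty := by
      by_contra he
      rw [Set.not_nonempty_iff_eq_empty] at he
      have h0 : firstPassage P u = 0 := by rw [firstPassage, he, Nat.sInf_empty]
      omega
    have h1 : u ∈ hexFaceVertices (P (firstPassage P u)) := (Nat.sInf_mem hne).1
    rw [hP _ hlt.le] at h1
    exact hu h1

/-- `firstPassage` along an exploration face sequence is at most its length. [folklore] -/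
theorem firstPassage_explorationFaces_le (E : DiscreteDobrushin) (ω : SiteConfig (Site 2))
    (u : Site 2) : firstPassage (explorationFaces E ω) u ≤ explorationLength E ω := by
  refine firstPassage_le_of_eventually_const (P := explorationFaces E ω)
    (L := explorationLength E ω) (fun i hi => ?_) u
  exact explorationFaces_of_explorationLength_le hi

/-- The two hexagons of the first crossed edge are first passed by the dart `0`. [folklore] -/
theorem firstPassage_eq_zero_of_mem {P : ℕ → HexVertex} {u : Site 2}
    (h0 : u ∈ hexFaceVertices (P 0)) (h1 : u ∈ hexFaceVertices (P 1)) : firstPassage P u = 0 :=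
  Nat.eq_zero_of_le_zero (firstPassage_le P ⟨h0, h1⟩)

/-! ### The zero gauge and the size of the windowed directions -/

/-- `tiltedExplorerInitAngle` unfolded: `φ + 2π · round ((τ − φ)/(2π))`. [folklore] -/
theorem tiltedExplorerInitAngle_eq_arg_add (β : Site 2 → ℝ) (f₀ f₁ : HexVertex) :
    tiltedExplorerInitAngle β f₀ f₁ = Complex.arg (hexCenter f₁ - hexCenter f₀) + 2 * Real.pi *
      (round ((Real.pi * (∑ u ∈ hexFaceVertices f₀ ∩ hexFaceVertices f₁, β u) / 2 + Real.pi / 2 -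
        Complex.arg (hexCenter f₁ - hexCenter f₀)) / (2 * Real.pi)) : ℝ) := rfl

/-- The anchored initial angle is a representative of `arg (c₁ − c₀)` modulo `2π`. [folklore] -/
theorem coe_tiltedExplorerInitAngle (β : Site 2 → ℝ) (f₀ f₁ : HexVertex) :
    ((tiltedExplorerInitAngle β f₀ f₁ : ℝ) : Real.Angle) =
      (Complex.arg (hexCenter f₁ - hexCenter f₀) : Real.Angle) := by
  rw [tiltedExplorerInitAngle_eq_arg_add, Real.Angle.coe_add, add_eq_left,
    Real.Angle.coe_eq_zero_iff]
  exact ⟨_, (zsmul_eq_mul _ _).trans (mul_comm _ _)⟩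

/-- Rounding to the nearest sheet: `|φ + 2π · round ((τ − φ)/(2π)) − τ| ≤ π`. [folklore] -/
theorem abs_add_round_sub_le (φ τ : ℝ) :
    |φ + 2 * Real.pi * (round ((τ - φ) / (2 * Real.pi)) : ℝ) - τ| ≤ Real.pi := by
  have h2π : (0 : ℝ) < 2 * Real.pi := by positivity
  have key : φ + 2 * Real.pi * (round ((τ - φ) / (2 * Real.pi)) : ℝ) - τ =
      -(2 * Real.pi * ((τ - φ) / (2 * Real.pi) - round ((τ - φ) / (2 * Real.pi)))) := by
    rw [mul_sub, mul_div_cancel₀ _ h2π.ne']; ring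
  rw [key, abs_neg, abs_mul, abs_of_pos h2π]
  calc 2 * Real.pi * |(τ - φ) / (2 * Real.pi) - round ((τ - φ) / (2 * Real.pi))|
      ≤ 2 * Real.pi * (1 / 2) := mul_le_mul_of_nonneg_left (abs_sub_round _) h2π.le
    _ = Real.pi := by ring

/-- The gauge anchor is within `π` of its target `τ = π (∑_{crossed edge} β)/2 + π/2`. [folklore] -/
theorem abs_gaugeAnchor_sub_le (β : Site 2 → ℝ) (f₀ f₁ : HexVertex) (φ : ℝ) :
    |gaugeAnchor β f₀ f₁ φ -
      (Real.pi * (∑ u ∈ hexFaceVertices f₀ ∩ hexFaceVertices f₁, β u) / 2 + Real.pi / 2)| ≤ Real.pi :=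
  abs_add_round_sub_le φ _

/-- **The gauge anchor hits a prescribed sheet**: if `A = φ + 2πk` is strictly within `π` of the
target, then `gaugeAnchor β f₀ f₁ φ = A`. [folklore] -/
theorem gaugeAnchor_eq_of_abs_sub_lt (β : Site 2 → ℝ) (f₀ f₁ : HexVertex) {φ A : ℝ} {k : ℤ}
    (hA : A = φ + 2 * Real.pi * k)
    (h : |Real.pi * (∑ u ∈ hexFaceVertices f₀ ∩ hexFaceVertices f₁, β u) / 2 + Real.pi / 2 - A| <
      Real.pi) :
    gaugeAnchor β f₀ f₁ φ = A := by
  have h2π : (0 : ℝ) < 2 * Real.pi := by positivity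
  set τ := Real.pi * (∑ u ∈ hexFaceVertices f₀ ∩ hexFaceVertices f₁, β u) / 2 + Real.pi / 2 with hτ
  have hg : gaugeAnchor β f₀ f₁ φ = φ + 2 * Real.pi * (round ((τ - φ) / (2 * Real.pi)) : ℝ) := rfl
  rw [abs_lt] at h
  have hround : round ((τ - φ) / (2 * Real.pi)) = k := by
    rw [round_eq_iff, Set.mem_Ico, le_div_iff₀ h2π, div_lt_iff₀ h2π]
    constructor <;> linarith [h.1, h.2]
  rw [hg, hround, hA]

/-- **The zero gauge picks the representative of `arg (c₁ − c₀)` closest to `π/2` (north)**: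
`|A₀ − π/2| ≤ π`. [folklore] -/
theorem abs_tiltedExplorerInitAngle_zero_sub_le (f₀ f₁ : HexVertex) :
    |tiltedExplorerInitAngle 0 f₀ f₁ - Real.pi / 2| ≤ Real.pi := by
  have h := abs_gaugeAnchor_sub_le 0 f₀ f₁ (Complex.arg (hexCenter f₁ - hexCenter f₀))
  simpa [tiltedExplorerInitAngle_eq_gaugeAnchor] using h

/-- If the target anchored on `β` is strictly within `π` of the zero-gauge angle `A₀`, the explorer's
initial angle in the gauge `β` IS `A₀`. [folklore] -/
theorem tiltedExplorerInitAngle_eq_of_abs_sub_lt (β : Site 2 → ℝ) (f₀ f₁ : HexVertex)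
    (h : |Real.pi * (∑ u ∈ hexFaceVertices f₀ ∩ hexFaceVertices f₁, β u) / 2 + Real.pi / 2 -
      tiltedExplorerInitAngle 0 f₀ f₁| < Real.pi) :
    tiltedExplorerInitAngle β f₀ f₁ = tiltedExplorerInitAngle 0 f₀ f₁ := by
  rw [tiltedExplorerInitAngle_eq_gaugeAnchor]
  exact gaugeAnchor_eq_of_abs_sub_lt β f₀ f₁ (tiltedExplorerInitAngle_eq_arg_add 0 f₀ f₁) h

/-- Turns are `±1` or `0`. [folklore] -/
theorem abs_hexPathTurn_le_one (P : ℕ → HexVertex) (j : ℕ) : |hexPathTurn P j| ≤ 1 := by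
  unfold hexPathTurn
  generalize ((hexCenter (P (j + 1)) - hexCenter (P j)) *
    (starRingEnd ℂ) (hexCenter (P j) - hexCenter (P (j - 1)))).im = r
  rcases Real.sign_apply_eq r with h | h | h <;> rw [h] <;> norm_num

/-- The unwrapped dart angle moves by at most `π/3` per dart: `|A_i − A_0| ≤ (π/3) i`. [folklore] -/
theorem abs_dartAngle_sub_dartAngle_zero_le (β : Site 2 → ℝ) (P : ℕ → HexVertex) (i : ℕ) :
    |dartAngle β P i - dartAngle β P 0| ≤ Real.pi / 3 * i := by
  have h : dartAngle β P i - dartAngle β P 0 = Real.pi / 3 * ∑ j ∈ Icc 1 i, hexPathTurn P j := by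
    rw [dartAngle_zero, dartAngle]; ring
  rw [h, abs_mul, abs_of_pos (by positivity : (0 : ℝ) < Real.pi / 3)]
  refine mul_le_mul_of_nonneg_left ?_ (by positivity)
  calc |∑ j ∈ Icc 1 i, hexPathTurn P j| ≤ ∑ j ∈ Icc 1 i, |hexPathTurn P j| :=
        abs_sum_le_sum_abs _ _
    _ ≤ ∑ j ∈ Icc 1 i, (1 : ℝ) := sum_le_sum fun j _ => abs_hexPathTurn_le_one P j
    _ = i := by simp

/-- Zero-gauge dart angles: `|A_i| ≤ 3π/2 + (π/3) i`. [folklore] -/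
theorem abs_dartAngle_zero_le (P : ℕ → HexVertex) (i : ℕ) :
    |dartAngle 0 P i| ≤ 3 * Real.pi / 2 + Real.pi / 3 * i := by
  have hπ := Real.pi_pos
  have h0 := abs_tiltedExplorerInitAngle_zero_sub_le (P 0) (P 1)
  rw [← dartAngle_zero] at h0
  have h1 := abs_dartAngle_sub_dartAngle_zero_le 0 P i
  rw [abs_le] at h0 h1 ⊢
  constructor <;> linarith [h0.1, h0.2, h1.1, h1.2]

/-- Zero-gauge windowed directions: `|Â_h(i)| ≤ 5π/2 + (π/3) i`. [folklore] -/
theorem abs_centredWindowAngle_zero_le (P : ℕ → HexVertex) (h i : ℕ) :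
    |centredWindowAngle 0 P h i| ≤ 5 * Real.pi / 2 + Real.pi / 3 * i := by
  have h1 := abs_centredWindowAngle_sub_dartAngle_le 0 P h i
  have h2 := abs_dartAngle_zero_le P i
  rw [abs_le] at h1 h2 ⊢
  constructor <;> linarith [h1.1, h1.2, h2.1, h2.2]

/-- The windowed direction lies in the sheet of the chord's argument:
`Â_h(i) ≡ arg (c_{i+1+h} − c_{i−h}) (mod 2π)`. [folklore] -/
theorem coe_centredWindowAngle (β : Site 2 → ℝ) (P : ℕ → HexVertex) (h i : ℕ) :
    ((centredWindowAngle β P h i : ℝ) : Real.Angle) =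
      (Complex.arg (hexCenter (P (i + 1 + h)) - hexCenter (P (i - h))) : Real.Angle) := by
  rw [centredWindowAngle, Real.Angle.coe_add, Real.Angle.coe_toReal, Real.Angle.coe_sub,
    add_sub_cancel]

/-- **No window at the first dart**: `Â_0(0) = A_0` (the chord over the dart `0` is `c₁ − c₀`,
whose argument the anchor represents). [folklore] -/
theorem centredWindowAngle_zero_zero (β : Site 2 → ℝ) (P : ℕ → HexVertex) :
    centredWindowAngle β P 0 0 = dartAngle β P 0 := by
  rw [centredWindowAngle, add_eq_left, Real.Angle.toReal_eq_zero_iff, Real.Angle.coe_sub,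
    sub_eq_zero, dartAngle_zero, coe_tiltedExplorerInitAngle]

/-! ### The boundary data -/

/-- **Arc-`A` winding datum** of the hexagon `u`, read along the `A`-hugging exploration path
`P_A = explorationFaces E ∅` (arc `A` on its LEFT): `−3/2 + (Â^{P_A}_m(i₀) − π)/π`,
`i₀ = firstPassage P_A u`, `Â = centredWindowAngle 0 P_A m i₀` (zero gauge, centred window of
`2m + 1` darts). Junk `−3/2` without a (unique) exploration path. [cite: MillerSheffield2016, Thm. 1.1 and Fig. 1.10] -/
def triArcAWinding (E : DiscreteDobrushin) (m : ℕ) (u : Site 2) : ℝ :=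
  if (explorationWalk E ∅).isSome then
    arcAProfile (centredWindowAngle 0 (explorationFaces E ∅) m (firstPassage (explorationFaces E ∅) u))
  else -(3 / 2)

/-- **Arc-`B` winding datum** of `u`, read along the `B`-hugging exploration path
`P_B = explorationFaces E univ` (arc `B ∖ A` on its RIGHT): `+3/2 + Â^{P_B}_m(i₀)/π`,
`i₀ = firstPassage P_B u`. Junk `+3/2` without a (unique) exploration path. [cite: MillerSheffield2016, Thm. 1.1 and Fig. 1.10] -/
def triArcBWinding (E : DiscreteDobrushin) (m : ℕ) (u : Site 2) : ℝ :=
  if (explorationWalk E Set.univ).isSome then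
    arcBProfile (centredWindowAngle 0 (explorationFaces E Set.univ) m
      (firstPassage (explorationFaces E Set.univ) u))
  else 3 / 2

open scoped Classical in
/-- **The lattice `κ = 8/3` imaginary-geometry boundary data** of the discrete Dobrushin domain `E`
with window half-width `m` (units `λ' = 1`: `λ = 3/2`, `χ = 1/π`; zero gauge): `triArcAWinding` on
the discrete arc `A`, `triArcBWinding` on `B ∖ A` (`A` wins on an overlap, as in `bcConfig`), `0`
off the arcs (never read). The arc data `β` fed to `tiltedExplorerMeasure E β (1/3) g` by the route.
[cite: MillerSheffield2016, Thm. 1.1 and Fig. 1.10] -/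
def triBoundaryWinding (E : DiscreteDobrushin) (m : ℕ) : Site 2 → ℝ := fun u =>
  if u ∈ E.triArcA then triArcAWinding E m u
  else if u ∈ E.triArcB then triArcBWinding E m u
  else 0

section Unfold

variable (E : DiscreteDobrushin) (m : ℕ)

/-- Unfolding `triArcAWinding` when the `A`-hugging path is defined. [folklore] -/
theorem triArcAWinding_of_isSome (h : (explorationWalk E ∅).isSome) (u : Site 2) :
    triArcAWinding E m u = arcAProfile
      (centredWindowAngle 0 (explorationFaces E ∅) m (firstPassage (explorationFaces E ∅) u)) := by
  rw [triArcAWinding, if_pos h]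

/-- The junk value of `triArcAWinding`. [folklore] -/
theorem triArcAWinding_of_eq_none (h : explorationWalk E ∅ = none) (u : Site 2) :
    triArcAWinding E m u = -(3 / 2) := by
  simp [triArcAWinding, h]

/-- Unfolding `triArcBWinding` when the `B`-hugging path is defined. [folklore] -/
theorem triArcBWinding_of_isSome (h : (explorationWalk E Set.univ).isSome) (u : Site 2) :
    triArcBWinding E m u = arcBProfile (centredWindowAngle 0 (explorationFaces E Set.univ) m
      (firstPassage (explorationFaces E Set.univ) u)) := by
  rw [triArcBWinding, if_pos h]

/-- The junk value of `triArcBWinding`. [folklore] -/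
theorem triArcBWinding_of_eq_none (h : explorationWalk E Set.univ = none) (u : Site 2) :
    triArcBWinding E m u = 3 / 2 := by
  simp [triArcBWinding, h]

/-- On the arc `A` the data are the arc-`A` winding data. [folklore] -/
theorem triBoundaryWinding_of_mem_triArcA {u : Site 2} (hu : u ∈ E.triArcA) :
    triBoundaryWinding E m u = triArcAWinding E m u := by
  simp only [triBoundaryWinding, if_pos hu]

/-- On `B ∖ A` the data are the arc-`B` winding data. [folklore] -/
theorem triBoundaryWinding_of_mem_triArcB {u : Site 2} (hB : u ∈ E.triArcB) (hA : u ∉ E.triArcA) :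
    triBoundaryWinding E m u = triArcBWinding E m u := by
  simp only [triBoundaryWinding, if_neg hA, if_pos hB]

/-- Off the arcs the data vanish. [folklore] -/
theorem triBoundaryWinding_of_not_mem {u : Site 2} (hA : u ∉ E.triArcA) (hB : u ∉ E.triArcB) :
    triBoundaryWinding E m u = 0 := by
  simp only [triBoundaryWinding, if_neg hA, if_neg hB]

/-- Off the arcs the data vanish. [folklore] -/
theorem triBoundaryWinding_of_not_mem_arcs {u : Site 2} (hu : u ∉ E.triArcA ∪ E.triArcB) :
    triBoundaryWinding E m u = 0 :=
  triBoundaryWinding_of_not_mem E m (fun h => hu (Or.inl h)) fun h => hu (Or.inr h)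

/-- The windowed direction at the first passing dart, in units of `π`: at most `5/2 + ℓ/3`, `ℓ`
the length of the path (the passing index is at most `ℓ`, each dart turns by `π/3`). [folklore] -/
theorem abs_centredWindowAngle_firstPassage_div_pi_le (ω : SiteConfig (Site 2)) (u : Site 2) :
    |centredWindowAngle 0 (explorationFaces E ω) m (firstPassage (explorationFaces E ω) u)| / Real.pi ≤
      5 / 2 + (explorationLength E ω : ℝ) / 3 := by
  have hπ := Real.pi_pos
  have hc := abs_centredWindowAngle_zero_le (explorationFaces E ω) m
    (firstPassage (explorationFaces E ω) u)
  have hi : (firstPassage (explorationFaces E ω) u : ℝ) ≤ explorationLength E ω := by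
    exact_mod_cast firstPassage_explorationFaces_le E ω u
  have hi' := mul_le_mul_of_nonneg_left hi (by positivity : (0 : ℝ) ≤ Real.pi / 3)
  rw [div_le_iff₀ hπ]
  nlinarith [hc, hi']

/-- **Boundedness on arc `A`**: `|β_A| ≤ 5 + ℓ/3`. [folklore] -/
theorem abs_triArcAWinding_le (u : Site 2) :
    |triArcAWinding E m u| ≤ 5 + (explorationLength E ∅ : ℝ) / 3 := by
  have hL : (0 : ℝ) ≤ explorationLength E ∅ := Nat.cast_nonneg _
  unfold triArcAWinding
  split_ifs with h
  · linarith [abs_arcAProfile_le (centredWindowAngle 0 (explorationFaces E ∅) m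
      (firstPassage (explorationFaces E ∅) u)), abs_centredWindowAngle_firstPassage_div_pi_le E m ∅ u]
  · rw [abs_neg, abs_of_pos (by norm_num : (0 : ℝ) < 3 / 2)]
    linarith

/-- **Boundedness on arc `B`**: `|β_B| ≤ 5 + ℓ/3`. [folklore] -/
theorem abs_triArcBWinding_le (u : Site 2) :
    |triArcBWinding E m u| ≤ 5 + (explorationLength E Set.univ : ℝ) / 3 := by
  have hL : (0 : ℝ) ≤ explorationLength E Set.univ := Nat.cast_nonneg _
  unfold triArcBWinding
  split_ifs with h
  · linarith [abs_arcBProfile_le (centredWindowAngle 0 (explorationFaces E Set.univ) m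
      (firstPassage (explorationFaces E Set.univ) u)),
      abs_centredWindowAngle_firstPassage_div_pi_le E m Set.univ u]
  · rw [abs_of_pos (by norm_num : (0 : ℝ) < 3 / 2)]
    linarith

/-- **The boundary data are bounded** (uniformly in the hexagon): `|β| ≤ 5 + (ℓ_∅ + ℓ_univ)/3`. [folklore] -/
theorem abs_triBoundaryWinding_le (u : Site 2) :
    |triBoundaryWinding E m u| ≤
      5 + ((explorationLength E ∅ : ℝ) + explorationLength E Set.univ) / 3 := by
  have hA := abs_triArcAWinding_le E m u
  have hB := abs_triArcBWinding_le E m u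
  have h0 : (0 : ℝ) ≤ explorationLength E ∅ := Nat.cast_nonneg _
  have h0' : (0 : ℝ) ≤ explorationLength E Set.univ := Nat.cast_nonneg _
  unfold triBoundaryWinding
  split_ifs
  · linarith
  · linarith
  · rw [abs_zero]; linarith

/-- The bound in the hypothesis shape `∀ u ∈ arcs, |β u| ≤ B` of the flow-line functionals. [folklore] -/
theorem abs_triBoundaryWinding_le_on_arcs :
    ∀ u ∈ E.triArcA ∪ E.triArcB, |triBoundaryWinding E m u| ≤
      5 + ((explorationLength E ∅ : ℝ) + explorationLength E Set.univ) / 3 :=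
  fun u _ => abs_triBoundaryWinding_le E m u

/-- Hence the centred-window flow-line functional with these arc data solves its Dirichlet problem
(`LatticeFlowLinePassage.lean`). [cite: SchrammSheffield2005, §2 (definition of HE)] -/
theorem isTriHarmonicExtension_latticeFlowLineHarmonicCentred_triBoundaryWinding (c g : ℝ) (h n : ℕ)
    (P : ℕ → HexVertex) :
    IsTriHarmonicExtension (triDiscreteDomainGraph E.Ω E.δ) (flowLineAbsorbing E P n)ᶜ
      (latticeFlowLineCentredData E (triBoundaryWinding E m) c g h n P)
      (latticeFlowLineHarmonicCentred E (triBoundaryWinding E m) c g h n P) :=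
  isTriHarmonicExtension_latticeFlowLineHarmonicCentred E _ c g h P
    (abs_triBoundaryWinding_le_on_arcs E m) n

end Unfold

/-! ### Sign check (2): the gauge identity at the first crossed edge -/

/-- **Both boundary-hugging exploration paths start with the dart `f₀ → f₁`, which crosses the
`A`–`B` edge `{x, y}`** (`x ∈ A`, `y ∈ B ∖ A`). For admissible data this is the situation at the
outer face `a_δ` (every exploration interface leaves `a_δ` across the boundary `A`–`B` edge at `a`,
keeping `A` on its left) — not proved here; it is the hypothesis of the gauge identity. [folklore] -/
structure IsCommonFirstDart (E : DiscreteDobrushin) (f₀ f₁ : HexVertex) (x y : Site 2) : Prop where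
  /-- The `A`-hugging path exists. -/
  isSome_empty : (explorationWalk E ∅).isSome
  /-- The `B`-hugging path exists. -/
  isSome_univ : (explorationWalk E Set.univ).isSome
  /-- The `A`-hugging path starts at `f₀`. -/
  faces_empty_zero : explorationFaces E ∅ 0 = f₀
  /-- Its first dart enters `f₁`. -/
  faces_empty_one : explorationFaces E ∅ 1 = f₁
  /-- The `B`-hugging path starts at `f₀`. -/
  faces_univ_zero : explorationFaces E Set.univ 0 = f₀
  /-- Its first dart enters `f₁`. -/
  faces_univ_one : explorationFaces E Set.univ 1 = f₁
  /-- The crossed edge of the first dart is `{x, y}`. -/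
  inter_eq : hexFaceVertices f₀ ∩ hexFaceVertices f₁ = {x, y}
  /-- `x` lies on the discrete arc `A` (on the left). -/
  left_mem : x ∈ E.triArcA
  /-- `y` lies on the discrete arc `B` (on the right) … -/
  right_mem : y ∈ E.triArcB
  /-- … and not on `A`. -/
  right_not_mem : y ∉ E.triArcA

namespace IsCommonFirstDart

variable {E : DiscreteDobrushin} {f₀ f₁ : HexVertex} {x y : Site 2}

/-- The two hexagons of the crossed edge are distinct. [folklore] -/
theorem ne (H : IsCommonFirstDart E f₀ f₁ x y) : x ≠ y := fun h => H.right_not_mem (h ▸ H.left_mem)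

/-- The value at the left hexagon `x_a`: `β_A(Â^{P_A}_m(0))`. [folklore] -/
theorem triBoundaryWinding_left (H : IsCommonFirstDart E f₀ f₁ x y) (m : ℕ) :
    triBoundaryWinding E m x = arcAProfile (centredWindowAngle 0 (explorationFaces E ∅) m 0) := by
  have hx : x ∈ hexFaceVertices f₀ ∩ hexFaceVertices f₁ := by rw [H.inter_eq]; simp
  rw [Finset.mem_inter, ← H.faces_empty_zero, ← H.faces_empty_one] at hx
  rw [triBoundaryWinding_of_mem_triArcA E m H.left_mem, triArcAWinding_of_isSome E m H.isSome_empty,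
    firstPassage_eq_zero_of_mem hx.1 hx.2]

/-- The value at the right hexagon `y_b`: `β_B(Â^{P_B}_m(0))`. [folklore] -/
theorem triBoundaryWinding_right (H : IsCommonFirstDart E f₀ f₁ x y) (m : ℕ) :
    triBoundaryWinding E m y = arcBProfile (centredWindowAngle 0 (explorationFaces E Set.univ) m 0) := by
  have hy : y ∈ hexFaceVertices f₀ ∩ hexFaceVertices f₁ := by rw [H.inter_eq]; simp
  rw [Finset.mem_inter, ← H.faces_univ_zero, ← H.faces_univ_one] at hy
  rw [triBoundaryWinding_of_mem_triArcB E m H.right_mem H.right_not_mem,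
    triArcBWinding_of_isSome E m H.isSome_univ, firstPassage_eq_zero_of_mem hy.1 hy.2]

/-- Both hugging paths have zero-gauge initial angle `A₀ = tiltedExplorerInitAngle 0 f₀ f₁`. [folklore] -/
theorem dartAngle_zero_empty (H : IsCommonFirstDart E f₀ f₁ x y) :
    dartAngle 0 (explorationFaces E ∅) 0 = tiltedExplorerInitAngle 0 f₀ f₁ := by
  rw [dartAngle_zero, H.faces_empty_zero, H.faces_empty_one]

/-- Both hugging paths have zero-gauge initial angle `A₀ = tiltedExplorerInitAngle 0 f₀ f₁`. [folklore] -/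
theorem dartAngle_zero_univ (H : IsCommonFirstDart E f₀ f₁ x y) :
    dartAngle 0 (explorationFaces E Set.univ) 0 = tiltedExplorerInitAngle 0 f₀ f₁ := by
  rw [dartAngle_zero, H.faces_univ_zero, H.faces_univ_one]

/-- The gauge target for window `m`: `A₀` plus the mean of the two window corrections at the first
dart. [folklore] -/
theorem gaugeTarget_eq (H : IsCommonFirstDart E f₀ f₁ x y) (m : ℕ) :
    Real.pi * (∑ u ∈ hexFaceVertices f₀ ∩ hexFaceVertices f₁, triBoundaryWinding E m u) / 2 +
        Real.pi / 2 =
      tiltedExplorerInitAngle 0 f₀ f₁ +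
        ((centredWindowAngle 0 (explorationFaces E ∅) m 0 - tiltedExplorerInitAngle 0 f₀ f₁) +
          (centredWindowAngle 0 (explorationFaces E Set.univ) m 0 - tiltedExplorerInitAngle 0 f₀ f₁)) /
          2 := by
  rw [H.inter_eq, Finset.sum_pair H.ne, H.triBoundaryWinding_left, H.triBoundaryWinding_right,
    ← gauge_arcProfile, add_sub_cancel, add_sub_cancel]

/-- For any window the gauge target is within `π` of `A₀` (the two corrections are principal
values). [folklore] -/
theorem abs_gaugeTarget_sub_le (H : IsCommonFirstDart E f₀ f₁ x y) (m : ℕ) :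
    |Real.pi * (∑ u ∈ hexFaceVertices f₀ ∩ hexFaceVertices f₁, triBoundaryWinding E m u) / 2 +
        Real.pi / 2 - tiltedExplorerInitAngle 0 f₀ f₁| ≤ Real.pi := by
  rw [H.gaugeTarget_eq, add_sub_cancel_left]
  have hA := abs_centredWindowAngle_sub_dartAngle_le 0 (explorationFaces E ∅) m 0
  have hB := abs_centredWindowAngle_sub_dartAngle_le 0 (explorationFaces E Set.univ) m 0
  rw [H.dartAngle_zero_empty] at hA
  rw [H.dartAngle_zero_univ] at hB
  rw [abs_le] at hA hB ⊢
  constructor <;> linarith [hA.1, hA.2, hB.1, hB.2]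

/-- **Sign check (2), the gauge identity** (`m = 0`): `π (β x_a + β y_b)/2 + π/2 = A₀`. [folklore] -/
theorem gauge_triBoundaryWinding_zero (H : IsCommonFirstDart E f₀ f₁ x y) :
    Real.pi * (∑ u ∈ hexFaceVertices f₀ ∩ hexFaceVertices f₁, triBoundaryWinding E 0 u) / 2 +
        Real.pi / 2 = tiltedExplorerInitAngle 0 f₀ f₁ := by
  rw [H.gaugeTarget_eq, centredWindowAngle_zero_zero, centredWindowAngle_zero_zero,
    H.dartAngle_zero_empty, H.dartAngle_zero_univ, sub_self, add_zero, zero_div, add_zero]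

/-- **The explorer's gauge anchored on `β = triBoundaryWinding E 0` is the zero gauge.** [folklore] -/
theorem tiltedExplorerInitAngle_triBoundaryWinding_zero (H : IsCommonFirstDart E f₀ f₁ x y) :
    tiltedExplorerInitAngle (triBoundaryWinding E 0) f₀ f₁ = tiltedExplorerInitAngle 0 f₀ f₁ :=
  tiltedExplorerInitAngle_eq_of_abs_sub_lt _ f₀ f₁
    (by rw [H.gauge_triBoundaryWinding_zero, sub_self, abs_zero]; exact Real.pi_pos)

/-- Hence `dartAngle β P = dartAngle 0 P` for every face sequence starting with `f₀ → f₁`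
(`β = triBoundaryWinding E 0`). [folklore] -/
theorem dartAngle_triBoundaryWinding_zero (H : IsCommonFirstDart E f₀ f₁ x y) {P : ℕ → HexVertex}
    (hP0 : P 0 = f₀) (hP1 : P 1 = f₁) (i : ℕ) :
    dartAngle (triBoundaryWinding E 0) P i = dartAngle 0 P i := by
  simp only [dartAngle, hP0, hP1, H.tiltedExplorerInitAngle_triBoundaryWinding_zero]

end IsCommonFirstDart

/-! ### The two-chain hygiene hypothesis -/

/-- **Clean two-arc structure of a discrete Dobrushin domain** (the lattice form of a
Kemppainen–Smirnov admissible hexagonal domain, `∂U = c₁ ∪ c₂` with the boundary hexagons next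
to the two chains): both boundary-hugging exploration paths exist, and every hexagon of the
discrete arc `A` (resp. of `B ∖ A`) that is `Ω_δ`-adjacent to a hexagon on neither arc (hence of
`triMeshDomain`, `triDiscreteDomainGraph_adj_iff`) is PASSED by the `A`-hugging path
`explorationFaces E ∅` (resp. the `B`-hugging path `explorationFaces E univ`). This makes
`triBoundaryWinding` meaningful (every arc hexagon facing the interior reads its datum off a dart
along it); mislabelled boundary islands would force detours of every interface and violate it.
`False` (junk) without (unique) exploration paths. Declared by dot-notation extension of
`DiscreteDobrushin` (`LatticeInterface.lean`). [cite: KemppainenSmirnov2017, §4.2 (admissible hexagonal domains)] -/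
def _root_.Literature.Probability.LatticeModels.DiscreteDobrushin.IsTwoChain (E : DiscreteDobrushin) :
    Prop :=
  (explorationWalk E ∅).isSome ∧ (explorationWalk E Set.univ).isSome ∧
    (∀ u ∈ E.triArcA,
      (∃ w, w ∉ E.triArcA ∧ w ∉ E.triArcB ∧ (triDiscreteDomainGraph E.Ω E.δ).Adj u w) →
        u ∈ passedHexagons (explorationFaces E ∅) (explorationLength E ∅)) ∧
    ∀ u ∈ E.triArcB, u ∉ E.triArcA →
      (∃ w, w ∉ E.triArcA ∧ w ∉ E.triArcB ∧ (triDiscreteDomainGraph E.Ω E.δ).Adj u w) →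
        u ∈ passedHexagons (explorationFaces E Set.univ) (explorationLength E Set.univ)

section TwoChain

variable {E : DiscreteDobrushin}

/-- Under `IsTwoChain` the `A`-hugging path exists. [folklore] -/
theorem _root_.Literature.Probability.LatticeModels.DiscreteDobrushin.IsTwoChain.isSome_empty
    (h : E.IsTwoChain) : (explorationWalk E ∅).isSome :=
  h.1

/-- Under `IsTwoChain` the `B`-hugging path exists. [folklore] -/
theorem _root_.Literature.Probability.LatticeModels.DiscreteDobrushin.IsTwoChain.isSome_univ
    (h : E.IsTwoChain) : (explorationWalk E Set.univ).isSome :=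
  h.2.1

/-- `IsTwoChain` is the junk `False` without an `A`-hugging path. [folklore] -/
theorem not_isTwoChain_of_eq_none_empty (h : explorationWalk E ∅ = none) : ¬ E.IsTwoChain :=
  fun H => by simpa [h] using H.isSome_empty

/-- `IsTwoChain` is the junk `False` without a `B`-hugging path. [folklore] -/
theorem not_isTwoChain_of_eq_none_univ (h : explorationWalk E Set.univ = none) : ¬ E.IsTwoChain :=
  fun H => by simpa [h] using H.isSome_univ

/-- Arc-`A` hexagons facing the interior are passed by the `A`-hugging path. [cite: KemppainenSmirnov2017, §4.2 (admissible hexagonal domains)] -/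
theorem _root_.Literature.Probability.LatticeModels.DiscreteDobrushin.IsTwoChain.mem_passedHexagons_of_mem_triArcA
    (h : E.IsTwoChain) {u w : Site 2} (hu : u ∈ E.triArcA) (hwA : w ∉ E.triArcA)
    (hwB : w ∉ E.triArcB) (hadj : (triDiscreteDomainGraph E.Ω E.δ).Adj u w) :
    u ∈ passedHexagons (explorationFaces E ∅) (explorationLength E ∅) :=
  h.2.2.1 u hu ⟨w, hwA, hwB, hadj⟩

/-- Arc-`B ∖ A` hexagons facing the interior are passed by the `B`-hugging path. [cite: KemppainenSmirnov2017, §4.2 (admissible hexagonal domains)] -/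
theorem _root_.Literature.Probability.LatticeModels.DiscreteDobrushin.IsTwoChain.mem_passedHexagons_of_mem_triArcB
    (h : E.IsTwoChain) {u w : Site 2} (huB : u ∈ E.triArcB) (huA : u ∉ E.triArcA)
    (hwA : w ∉ E.triArcA) (hwB : w ∉ E.triArcB) (hadj : (triDiscreteDomainGraph E.Ω E.δ).Adj u w) :
    u ∈ passedHexagons (explorationFaces E Set.univ) (explorationLength E Set.univ) :=
  h.2.2.2 u huB huA ⟨w, hwA, hwB, hadj⟩

/-- **The datum of an arc-`A` hexagon facing the interior is read off a dart along it**: its first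
passing dart exists (`i₀ < ℓ`) and crosses an edge at `u`. [folklore] -/
theorem _root_.Literature.Probability.LatticeModels.DiscreteDobrushin.IsTwoChain.firstPassage_lt_of_mem_triArcA
    (h : E.IsTwoChain) {u w : Site 2} (hu : u ∈ E.triArcA) (hwA : w ∉ E.triArcA)
    (hwB : w ∉ E.triArcB) (hadj : (triDiscreteDomainGraph E.Ω E.δ).Adj u w) :
    firstPassage (explorationFaces E ∅) u < explorationLength E ∅ ∧
      u ∈ hexFaceVertices (explorationFaces E ∅ (firstPassage (explorationFaces E ∅) u)) ∧
      u ∈ hexFaceVertices (explorationFaces E ∅ (firstPassage (explorationFaces E ∅) u + 1)) :=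
  firstPassage_spec _ (h.mem_passedHexagons_of_mem_triArcA hu hwA hwB hadj)

/-- The same on the arc `B ∖ A`. [folklore] -/
theorem _root_.Literature.Probability.LatticeModels.DiscreteDobrushin.IsTwoChain.firstPassage_lt_of_mem_triArcB
    (h : E.IsTwoChain) {u w : Site 2} (huB : u ∈ E.triArcB) (huA : u ∉ E.triArcA)
    (hwA : w ∉ E.triArcA) (hwB : w ∉ E.triArcB) (hadj : (triDiscreteDomainGraph E.Ω E.δ).Adj u w) :
    firstPassage (explorationFaces E Set.univ) u < explorationLength E Set.univ ∧
      u ∈ hexFaceVertices (explorationFaces E Set.univ (firstPassage (explorationFaces E Set.univ) u)) ∧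
      u ∈ hexFaceVertices
        (explorationFaces E Set.univ (firstPassage (explorationFaces E Set.univ) u + 1)) :=
  firstPassage_spec _ (h.mem_passedHexagons_of_mem_triArcB huB huA hwA hwB hadj)

end TwoChain

end Literature.Probability.RandomPlanarGeometry

end
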